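import Literature.Probability.Percolation.QuadCrossingSpace
import Literature.Probability.RandomPlanarGeometry.QuadPresentations
import Literature.Probability.RandomPlanarGeometry.ConformalRectangleShift
import Literature.Probability.RandomPlanarGeometry.ImageUnivalent
import Literature.Probability.RandomPlanarGeometry.CardyFunctionIncBeta
import Summits.CriticalPhenomena.CardyFormulaZ2.Theorems.CardyMeckeFlipMeckeRigidityCrossingHalf

/-!
# The self-duality content of `MeckeRigidity`: transposition of Cardy values, conformal squares

Route `Summits/CriticalPhenomena/CardyFormulaZ2/Theses/CardyMeckeFlip`, crux `MeckeRigidity`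
(item stmt-CriticalPhenomena-14826), line `registered` (helper file, `--supports`).

The crux asks that a law `P` on the Schramm–Smirnov space satisfying (E2) isometry invariance, (D)
exact self-duality, (RSW), an admissible flip-fair extremal kernel family ((ADM), (F), (EXT)) give
every quad `Q` of a conformal rectangle `R = (Ω; P₀, P₁, P₂, P₃)` the Cardy value
`F(crossRatio x)` of any uniformizing datum `(φ, x)`.  This file isolates what the two hypotheses
on the LAW alone — (D), and (D) + (E2) — already give towards that conclusion, with the exact
conclusion shape of the crux:

* `crossRatio_eq_one_sub_of_pt_succ` — **transposition law of the conformal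
  modulus**: if `S` re-marks the quad of `R` cyclically (`S.carrier = R.carrier`,
  `S.pt i = R.pt (i+1)`), then `crossRatio x' = 1 - crossRatio x` for arbitrary uniformizing data
  `(φ', x')` of `S` and `(φ, x)` of `R` (both read off one disc chart; the complex cross-ratio of
  `(ζ₁, ζ₂, ζ₃, ζ₀)` is `1 -` that of `(ζ₀, ζ₁, ζ₂, ζ₃)`);
* `exists_shift_pt` — the cyclically re-marked rectangle `(Ω; P₁, P₂, P₃, P₀)`
  exists with the same carrier, points and arcs shifted by one (from `exists_shiftMarks`);
* `cardyValue_transpose` — **under (D) alone the conclusion of the crux transposes**: if `Q` (quad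
  of `R`) has `P`-value `F(η_R)`, then the transposed quad `Q'` (quad of the re-marked `R'`) has
  `P`-value `F(η_{R'})`, because `P(⊞_Q) + P(⊞_{Q'}) = 1` ((D), one-quad sum rule) and
  `F(η_{R'}) = F(1 - η_R) = 1 - F(η_R)` (`cardyFunction_one_sub`);
* `cardyValue_of_transposing_rotation` — **under (E2) + (D) the conclusion of the crux HOLDS on
  every conformal rectangle with a transposing rotation**: if a holomorphic plane isometry
  `z ↦ a z + b` (`‖a‖ = 1`) maps `Ω` onto itself, `P_i ↦ P_{i+1}` and `arc i ↦ arc (i+1)`, then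
  `P(⊞_Q) = 1/2` (`measureReal_crossedEvent_eq_half`) and `crossRatio x = 1/2` (transport of the
  datum by the rotation + the transposition law), and `F(1/2) = 1/2`.

No flip structure is used: this is the (ADM)/(F)/(EXT)-free part of the crux; beyond the
self-dual point `η = 1/2` the conclusion needs the flip hypotheses.
-/

noncomputable section

open MeasureTheory Set Filter Metric Complex
open _root_.Topology
open UpperHalfPlane (upperHalfPlaneSet)
open Literature.Probability.Percolation Literature.Probability.Percolation.QuadCrossing
open Literature.Probability.RandomPlanarGeometry

/-! ### The transposition law of the conformal modulus -/

namespace Summit.CriticalPhenomena.CardyFormulaZ2.Theorems.CardyMeckeFlip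

/-- The complex cross-ratio of the cyclically shifted tuple `(ζ₁, ζ₂, ζ₃, ζ₀)` is `1 -` the
cross-ratio of `(ζ₀, ζ₁, ζ₂, ζ₃)` (for pairwise distinct points). [cite: AhlforsCA1979, Ch. 3 §3.1] -/
theorem cCrossRatio_shift {ζ : Fin 4 → ℂ} (h : Function.Injective ζ) :
    cCrossRatio ![ζ 1, ζ 2, ζ 3, ζ 0] = 1 - cCrossRatio ζ := by
  have h02 : ζ 0 - ζ 2 ≠ 0 := sub_ne_zero.2 (h.ne (by decide))
  have h13 : ζ 1 - ζ 3 ≠ 0 := sub_ne_zero.2 (h.ne (by decide))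
  have h20 : ζ 2 - ζ 0 ≠ 0 := sub_ne_zero.2 (h.ne (by decide))
  simp only [cCrossRatio, Matrix.cons_val_zero, Matrix.cons_val_one, Matrix.cons_val]
  field_simp
  ring

/-- **Transposition law of the conformal modulus.** If `S` is the quad of `R` re-marked
cyclically by one (`S.carrier = R.carrier`, `S.pt i = R.pt (i + 1)`), then for arbitrary
uniformizing data `(φ', x')` of `S` and `(φ, x)` of `R`, `crossRatio x' = 1 - crossRatio x`.
Both cross-ratios are read off one disc chart of the common carrier
(`ofReal_crossRatio_eq_cCrossRatio`). [cite: AhlforsCA1979, Ch. 3 §3.1 and Ch. 6 §1.1] -/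
theorem crossRatio_eq_one_sub_of_pt_succ {R S : ConformalRectangle} (hc : S.carrier = R.carrier)
    (hpt : ∀ i, S.pt i = R.pt (i + 1))
    {φ' : ConformalEquiv upperHalfPlaneSet S.carrier} {x' : Fin 4 → ℝ}
    (hφ' : S.IsUniformizing φ' x') {φ : ConformalEquiv upperHalfPlaneSet R.carrier}
    {x : Fin 4 → ℝ} (hφ : R.IsUniformizing φ x) : crossRatio x' = 1 - crossRatio x := by
  -- make the two carriers definitionally equal
  obtain ⟨⟨c, b, ho, hbd, hconn, hb, hper, hinj, hrange⟩, m, hm, hmem⟩ := S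
  change c = R.carrier at hc
  subst hc
  set S : ConformalRectangle := ⟨⟨R.carrier, b, ho, hbd, hconn, hb, hper, hinj, hrange⟩, m, hm,
    hmem⟩ with hS
  -- a disc chart of the common carrier and its Carathéodory extension
  obtain ⟨f₀⟩ := exists_conformalEquiv_ball_holds (U := R.carrier) R.isOpen
    R.isSimplyConnected_carrier R.carrier_ne_univ
  obtain ⟨Φ, hΦc, hΦeq, hΦbij, hΦsph⟩ :=
    JordanDomain.exists_continuousOn_extension_holds R.toJordanDomain f₀.symm
  have hcorner : ∀ i, ∃ ζ ∈ sphere (0 : ℂ) 1, Φ ζ = R.pt i := fun i ↦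
    hΦsph.surjOn (R.pt_mem_frontier i)
  choose ζ hζs hΦζ using hcorner
  have hζ : ∀ i, ζ i ∈ closedBall (0 : ℂ) 1 := fun i ↦ sphere_subset_closedBall (hζs i)
  have hx : (crossRatio x : ℂ) = cCrossRatio ζ :=
    R.ofReal_crossRatio_eq_cCrossRatio f₀.symm hΦc hΦeq hΦbij.injOn hζ hΦζ hφ
  -- the circle preimages of the corners are pairwise distinct
  have hζinj : Function.Injective ζ := fun i j h ↦
    R.pt_injective (by rw [← hΦζ i, ← hΦζ j, h])
  -- the shifted tuple `(ζ₁, ζ₂, ζ₃, ζ₀)` realises the marked points of `S`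
  have hζ' : ∀ i, (![ζ 1, ζ 2, ζ 3, ζ 0] : Fin 4 → ℂ) i ∈ closedBall (0 : ℂ) 1 := by
    intro i; fin_cases i <;> simp [hζ]
  have hΦζ' : ∀ i, Φ ((![ζ 1, ζ 2, ζ 3, ζ 0] : Fin 4 → ℂ) i) = S.pt i := by
    intro i
    fin_cases i
    · simpa [hpt] using hΦζ 1
    · simpa [hpt] using hΦζ 2
    · simpa [hpt] using hΦζ 3
    · simpa [hpt] using hΦζ 0
  have hx' : (crossRatio x' : ℂ) = cCrossRatio ![ζ 1, ζ 2, ζ 3, ζ 0] :=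
    S.ofReal_crossRatio_eq_cCrossRatio f₀.symm hΦc hΦeq hΦbij.injOn hζ' hΦζ' hφ'
  rw [cCrossRatio_shift hζinj, ← hx] at hx'
  exact_mod_cast hx'

/-- **The cyclically re-marked rectangle** `(Ω; P₁, P₂, P₃, P₀)`: same carrier, marked points and
arcs shifted by one. [folklore] -/
theorem exists_shift_pt (R : ConformalRectangle) : ∃ R' : ConformalRectangle,
    R'.carrier = R.carrier ∧ (∀ i, R'.pt i = R.pt (i + 1)) ∧ ∀ k, R'.arc k = R.arc (k + 1) := by
  obtain ⟨R', hc, hb, hm, h0, h1, h2, h3⟩ := MarkedDomain.exists_shiftMarks R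
  refine ⟨R', hc, fun i => ?_, fun k => ?_⟩
  · show R'.boundary (R'.mark i) = R.boundary (R.mark (i + 1))
    rw [hb, hm]
    fin_cases i
    · simp
    · simp
    · simp
    · show R.boundary ((![0, R.mark 2 - R.mark 1, R.mark 3 - R.mark 1, R.mark 0 + 1 - R.mark 1]
        : Fin 4 → ℝ) 3 + R.mark 1) = R.boundary (R.mark (3 + 1))
      have e : (![0, R.mark 2 - R.mark 1, R.mark 3 - R.mark 1, R.mark 0 + 1 - R.mark 1]
        : Fin 4 → ℝ) 3 = R.mark 0 + 1 - R.mark 1 := rfl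
      rw [e, show R.mark 0 + 1 - R.mark 1 + R.mark 1 = R.mark 0 + 1 by ring, R.periodic_boundary]
      rfl
  · fin_cases k
    · exact h0
    · exact h1
    · exact h2
    · exact h3


/-! ### (D): one-quad sum rule without (E2) -/

/-- **One-quad sum rule from (D) alone**: for a transpose `Qᵗ` of `Q` (same carrier, sides
shifted by one), `P.real ⊞_Q + P.real ⊞_{Qᵗ} = 1`. [folklore] -/
theorem measureReal_crossedEvent_add_transpose (P : Measure (QuadConfig (univ : Set ℂ)))
    [IsProbabilityMeasure P]
    (hD : ∀ (n : ℕ) (Q Qt : Fin n → Quad (univ : Set ℂ)),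
      (∀ i, (Qt i).carrier = (Q i).carrier ∧ (Qt i).side 0 = (Q i).side 1 ∧
        (Qt i).side 1 = (Q i).side 2 ∧ (Qt i).side 2 = (Q i).side 3 ∧ (Qt i).side 3 = (Q i).side 0) →
      ∀ A : Set (Set (Fin n)), P {S | {i | Q i ∈ S} ∈ A} = P {S | {i | Qt i ∉ S} ∈ A})
    (Q Qt : Quad (univ : Set ℂ))
    (ht : Qt.carrier = Q.carrier ∧ Qt.side 0 = Q.side 1 ∧ Qt.side 1 = Q.side 2 ∧
      Qt.side 2 = Q.side 3 ∧ Qt.side 3 = Q.side 0) :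
    P.real (QuadConfig.crossedEvent Q) + P.real (QuadConfig.crossedEvent Qt) = 1 := by
  -- (D) on the one-quad family, tested on the pattern "index 0 is crossed"
  have key := hD 1 (fun _ => Q) (fun _ => Qt) (fun _ => ht) {T | (0 : Fin 1) ∈ T}
  have hL : {S : QuadConfig (univ : Set ℂ) | {i : Fin 1 | Q ∈ S} ∈ {T : Set (Fin 1) | (0 : Fin 1) ∈ T}}
      = QuadConfig.crossedEvent Q := by
    ext S; simp
  have hR : {S : QuadConfig (univ : Set ℂ) | {i : Fin 1 | Qt ∉ S} ∈ {T : Set (Fin 1) | (0 : Fin 1) ∈ T}}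
      = (QuadConfig.crossedEvent Qt)ᶜ := by
    ext S; simp
  rw [hL, hR, prob_compl_eq_one_sub (QuadConfig.measurableSet_crossedEvent Qt)] at key
  -- the `ℝ≥0∞` identity `P ⊞_Q + P ⊞_{Qᵗ} = 1`, then pass to real numbers
  have h : P (QuadConfig.crossedEvent Q) + P (QuadConfig.crossedEvent Qt) = 1 := by
    rw [key]
    exact tsub_add_cancel_of_le prob_le_one
  have h' := congrArg ENNReal.toReal h
  rwa [ENNReal.toReal_add (measure_ne_top P _) (measure_ne_top P _), ENNReal.toReal_one] at h'

/-! ### (D): the conclusion of the crux transposes -/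

/-- **Under (D) alone, Cardy values transpose.** Let `R'` re-mark `R` cyclically by one
(`R'.carrier = R.carrier`, `R'.pt i = R.pt (i+1)`), let `Q`, `Q'` be quads with
`[Q] = closure Ω`, `[Q'] = closure Ω` and `∂ₖQ' = ∂ₖ₊₁Q` (e.g. `∂ₖQ = R.arc k`,
`∂ₖQ' = R'.arc k`), and let `(φ, x)`, `(φ', x')` uniformize `R`, `R'`.  If `P(⊞_Q) = F(η_R)` then
`P(⊞_{Q'}) = F(η_{R'})`: `P(⊞_Q) + P(⊞_{Q'}) = 1`, `η_{R'} = 1 - η_R`, `F(1 - η) = 1 - F(η)`.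
[folklore] -/
theorem cardyValue_transpose (P : Measure (QuadConfig (univ : Set ℂ))) [IsProbabilityMeasure P]
    (hD : ∀ (n : ℕ) (Q Qt : Fin n → Quad (univ : Set ℂ)),
      (∀ i, (Qt i).carrier = (Q i).carrier ∧ (Qt i).side 0 = (Q i).side 1 ∧
        (Qt i).side 1 = (Q i).side 2 ∧ (Qt i).side 2 = (Q i).side 3 ∧ (Qt i).side 3 = (Q i).side 0) →
      ∀ A : Set (Set (Fin n)), P {S | {i | Q i ∈ S} ∈ A} = P {S | {i | Qt i ∉ S} ∈ A})
    {R R' : ConformalRectangle} (hc : R'.carrier = R.carrier) (hpt : ∀ i, R'.pt i = R.pt (i + 1))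
    {φ : ConformalEquiv upperHalfPlaneSet R.carrier} {x : Fin 4 → ℝ} (hφ : R.IsUniformizing φ x)
    {φ' : ConformalEquiv upperHalfPlaneSet R'.carrier} {x' : Fin 4 → ℝ}
    (hφ' : R'.IsUniformizing φ' x')
    {Q Q' : Quad (univ : Set ℂ)} (hQc : Q.carrier = closure R.carrier)
    (hQ'c : Q'.carrier = closure R'.carrier)
    (hside : Q'.side 0 = Q.side 1 ∧ Q'.side 1 = Q.side 2 ∧ Q'.side 2 = Q.side 3 ∧
      Q'.side 3 = Q.side 0)
    (hval : P.real (QuadConfig.crossedEvent Q) = Literature.Probability.RandomPlanarGeometry.cardyFunction (crossRatio x)) :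
    P.real (QuadConfig.crossedEvent Q') = Literature.Probability.RandomPlanarGeometry.cardyFunction (crossRatio x') := by
  have hsum := measureReal_crossedEvent_add_transpose P hD Q Q'
    ⟨by rw [hQ'c, hc, hQc], hside.1, hside.2.1, hside.2.2.1, hside.2.2.2⟩
  have hη : crossRatio x' = 1 - crossRatio x := crossRatio_eq_one_sub_of_pt_succ hc hpt hφ' hφ
  have hmem := ConformalRectangle.crossRatio_mem_Ioo_of_isUniformizing hφ
  have hF := cardyFunction_one_sub_holds (η := crossRatio x) ⟨hmem.1.le, hmem.2.le⟩
  rw [hη, hF]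
  linarith [hsum, hval]

/-! ### (E2) + (D): conformal squares with a transposing rotation -/

/-- **Under (E2) + (D), the conclusion of `MeckeRigidity` holds on every conformal rectangle with
a transposing rotation.** Let `R = (Ω; P₀, …, P₃)` be a conformal rectangle and `z ↦ a z + b`
(`‖a‖ = 1`) a holomorphic plane isometry mapping `Ω` onto itself with `P_i ↦ P_{i+1}` and
`arc i ↦ arc (i+1)` (squares with their corners, discs with four quarter points, …).  Then for
every isometry-invariant, exactly self-dual probability law `P` on `ℋ_ℂ`, every uniformizing
datum `(φ, x)` of `R` and every quad `Q` with `[Q] = closure Ω`, `∂ₖQ = R.arc k`: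
`P(⊞_Q) = F(crossRatio x)` — both sides equal `1/2` (`measureReal_crossedEvent_eq_half`;
`crossRatio x = 1/2` by transporting the datum along the rotation onto the re-marked rectangle
and the transposition law; `F(1/2) = 1/2` by `cardyFunction_one_sub`). [folklore] -/
theorem cardyValue_of_transposing_rotation (P : Measure (QuadConfig (univ : Set ℂ)))
    [IsProbabilityMeasure P]
    (hE2 : ∀ g : ℂ ≃ᵢ ℂ, Measure.map (QuadConfig.isometry g) P = P)
    (hD : ∀ (n : ℕ) (Q Qt : Fin n → Quad (univ : Set ℂ)),
      (∀ i, (Qt i).carrier = (Q i).carrier ∧ (Qt i).side 0 = (Q i).side 1 ∧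
        (Qt i).side 1 = (Q i).side 2 ∧ (Qt i).side 2 = (Q i).side 3 ∧ (Qt i).side 3 = (Q i).side 0) →
      ∀ A : Set (Set (Fin n)), P {S | {i | Q i ∈ S} ∈ A} = P {S | {i | Qt i ∉ S} ∈ A})
    (R : ConformalRectangle) {a b : ℂ} (ha : ‖a‖ = 1)
    (hΩ : (fun z => a * z + b) '' R.carrier = R.carrier)
    (hpt : ∀ i, a * R.pt i + b = R.pt (i + 1))
    (harc : ∀ k, (fun z => a * z + b) '' R.arc k = R.arc (k + 1))
    (φ : ConformalEquiv upperHalfPlaneSet R.carrier) (x : Fin 4 → ℝ) (hφ : R.IsUniformizing φ x)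
    (Q : Quad (univ : Set ℂ)) (hQc : Q.carrier = closure R.carrier) (h0 : Q.side 0 = R.arc 0)
    (h1 : Q.side 1 = R.arc 1) (h2 : Q.side 2 = R.arc 2) (h3 : Q.side 3 = R.arc 3) :
    P.real (QuadConfig.crossedEvent Q) = Literature.Probability.RandomPlanarGeometry.cardyFunction (crossRatio x) := by
  have ha0 : a ≠ 0 := fun h => by simp [h] at ha
  -- the plane isometry `z ↦ a z + b`
  let g : ℂ ≃ᵢ ℂ :=
    { toFun := fun z => a * z + b
      invFun := fun w => a⁻¹ * (w - b)
      left_inv := fun z => by simp [ha0]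
      right_inv := fun w => by field_simp; ring
      isometry_toFun := Isometry.of_dist_eq fun z w => by
        simp only [dist_eq_norm]
        rw [show a * z + b - (a * w + b) = a * (z - w) by ring, norm_mul, ha, one_mul] }
  have hgfun : (⇑g.toHomeomorph : ℂ → ℂ) = fun z => a * z + b := rfl
  -- the rotated quad `g · Q` is the transpose of `Q`
  have ht : (Q.isometry g).carrier = Q.carrier ∧ (Q.isometry g).side 0 = Q.side 1 ∧
      (Q.isometry g).side 1 = Q.side 2 ∧ (Q.isometry g).side 2 = Q.side 3 ∧
      (Q.isometry g).side 3 = Q.side 0 := by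
    simp only [quad_isometry_eq_mapHomeomorph, Quad.carrier_mapHomeomorph, Quad.side_mapHomeomorph]
    refine ⟨?_, ?_, ?_, ?_, ?_⟩
    · rw [hQc, Homeomorph.image_closure, hgfun, hΩ]
    · rw [hgfun, h0, h1]; exact harc 0
    · rw [hgfun, h1, h2]; exact harc 1
    · rw [hgfun, h2, h3]; exact harc 2
    · rw [hgfun, h3, h0]; exact harc 3
  have hP : P.real (QuadConfig.crossedEvent Q) = 1 / 2 :=
    measureReal_crossedEvent_eq_half P hE2 hD Q g ht
  -- the cross-ratio is `1/2`: transport the datum along the rotation onto the re-marked rectangle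
  obtain ⟨R', hc', hpt', -⟩ := exists_shift_pt R
  have hd : DifferentiableOn ℂ (fun z => a * z + b) R.carrier := by fun_prop
  have hi : InjOn (fun z => a * z + b) R.carrier := by
    intro z _ w _ hzw
    have : a * z = a * w := add_right_cancel hzw
    exact mul_left_cancel₀ ha0 this
  have hcont : ContinuousOn (fun z => a * z + b) (closure R.carrier) := by fun_prop
  have hS : R'.carrier = (fun z => a * z + b) '' R.carrier := by rw [hc']; exact hΩ.symm
  have hptS : ∀ i, R'.pt i = (fun z => a * z + b) (R.pt i) := fun i => by
    rw [hpt' i]; exact (hpt i).symm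
  have hU := hφ.image_data hd hi hcont hS hptS
  have hη' := crossRatio_eq_one_sub_of_pt_succ hc' hpt' hU hφ
  have hη : crossRatio x = 1 / 2 := by linarith
  -- `F(1/2) = 1/2`
  have hF := cardyFunction_one_sub_holds (η := 1 / 2) ⟨by norm_num, by norm_num⟩
  norm_num at hF
  have hF' : Literature.Probability.RandomPlanarGeometry.cardyFunction (1 / 2) = 1 / 2 := by
    linarith
  rw [hP, hη, hF']

end Summit.CriticalPhenomena.CardyFormulaZ2.Theorems.CardyMeckeFlip

end
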